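import Literature.AnabelianGeometry.AbsoluteAnabelian.AutHolomorphicSpaces
import Literature.Analysis.Complex.InjectiveHolomorphic
import Mathlib.Geometry.Manifold.MFDeriv.Atlas
import Mathlib.Geometry.Manifold.MFDeriv.Basic
import Mathlib.Analysis.Complex.Conformal
import Mathlib.Analysis.Calculus.Deriv.Star
import HarnessLib

/-!
# Holomorphic versus anti-holomorphic points of a homeomorphism of Riemann surfaces

PROOF-ONLY support for [AbsTopIII] Cor. 2.3 (ii) (`PreAutHolStructureExtendsUnique` in
`AutHolomorphicSpaces`).  For a homeomorphism `φ : X ≃ₜ Y` of Riemann surfaces which is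
RC-holomorphic together with its inverse (the conclusion of Prop. 2.2 (i) / Cor. 2.3 (i)), the two
kinds of points — `IsHolAt φ p` and `IsAntiHolAt φ p` of [AbsTopIII] Def. 2.1 (ii) — behave as
expected:

* `not_isHolAt_and_isAntiHolAt` — they exclude each other (a map holomorphic and anti-holomorphic
  at a point has vanishing derivative there, by the Cauchy–Riemann equations, while an injective
  holomorphic map has non-vanishing derivative: the tree's `SCV.deriv_ne_zero_of_injOn`);
* `isHolAt_symm_of_isHolAt`, `isAntiHolAt_symm_of_isAntiHolAt` — the inverse has the same type;
* `forall_isHolAt_or_forall_isAntiHolAt` — on a preconnected set the type is constant;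
* `mdifferentiableAt_conj_homeomorph` — conjugating a `ℂ`-differentiable self-map `ψ` of `X` by
  `φ` gives a `ℂ`-differentiable map at `φ p` as soon as `p` and `ψ p` have the same type
  (`anti ∘ hol ∘ anti = hol` in charts, via `differentiableAt_conj_conj_iff`).

[cite: MochizukiAbsTopIII2015, Corollary 2.3 (ii) p.53]
-/

noncomputable section

namespace Literature.AnabelianGeometry.AbsoluteAnabelian

universe u

open _root_.TopologicalSpace _root_.Topology _root_.Set _root_.Metric _root_.Function _root_.Filter
open scoped _root_.Manifold _root_.ContDiff ComplexConjugate

/-! ### Two facts of one complex variable -/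

/-- A map `T : ℂ → ℂ` which is `ℂ`-differentiable at `w` together with `conj ∘ T` has derivative
zero at `w` (Cauchy–Riemann for both). [cite: MochizukiAbsTopIII2015, Definition 2.1 (ii) p.51] -/
theorem deriv_eq_zero_of_differentiableAt_conj_comp {T : ℂ → ℂ} {w : ℂ} (h1 : DifferentiableAt ℂ T w)
    (h2 : DifferentiableAt ℂ (conj ∘ T) w) : deriv T w = 0 := by
  have cr1 := (differentiableAt_complex_iff_differentiableAt_real.1 h1).2
  have cr2 := (differentiableAt_complex_iff_differentiableAt_real.1 h2).2
  have hR : DifferentiableAt ℝ T w := h1.restrictScalars ℝ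
  have hc : (conj ∘ T : ℂ → ℂ) = (⇑Complex.conjCLE) ∘ T :=
    funext fun z => (Complex.conjCLE_apply (T z)).symm
  have hfd : fderiv ℝ (conj ∘ T) w = (Complex.conjCLE : ℂ →L[ℝ] ℂ).comp (fderiv ℝ T w) := by
    rw [hc, fderiv_comp w Complex.conjCLE.differentiableAt hR, Complex.conjCLE.fderiv]
  have e1 : fderiv ℝ (conj ∘ T) w Complex.I = conj (fderiv ℝ T w Complex.I) := by
    rw [hfd, ContinuousLinearMap.comp_apply, ContinuousLinearEquiv.coe_coe, Complex.conjCLE_apply]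
  have e2 : fderiv ℝ (conj ∘ T) w 1 = conj (fderiv ℝ T w 1) := by
    rw [hfd, ContinuousLinearMap.comp_apply, ContinuousLinearEquiv.coe_coe, Complex.conjCLE_apply]
  set a := fderiv ℝ T w 1 with ha_def
  rw [e1, e2, cr1, smul_eq_mul, smul_eq_mul, map_mul, Complex.conj_I] at cr2
  -- `cr2 : -I * conj a = I * conj a`
  have h3 : (2 : ℂ) * (Complex.I * conj a) = 0 := by linear_combination -cr2
  have h4 : conj a = 0 :=
    (mul_eq_zero.1 ((mul_eq_zero.1 h3).resolve_left two_ne_zero)).resolve_left Complex.I_ne_zero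
  have h5 : a = 0 := by simpa using congrArg conj h4
  rw [← fderiv_apply_one_eq_deriv]
  have h6 : (fderiv ℝ T w) 1 = (fderiv ℂ T w) 1 := by
    rw [h1.fderiv_restrictScalars ℝ, ContinuousLinearMap.coe_restrictScalars']
  rw [← h6]
  exact h5

/-! ### Chart expressions -/

section Charts

variable {X Y : Type u} [TopologicalSpace X] [ChartedSpace ℂ X] [IsManifold 𝓘(ℂ, ℂ) ω X]
  [TopologicalSpace Y] [ChartedSpace ℂ Y] [IsManifold 𝓘(ℂ, ℂ) ω Y]

omit [IsManifold 𝓘(ℂ, ℂ) ω X] [IsManifold 𝓘(ℂ, ℂ) ω Y] in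
/-- The preferred chart expression of a map `ℂ`-differentiable at `p` is differentiable at the base
point. [cite: MochizukiAbsTopIII2015, Definition 2.1 (ii) p.51] -/
theorem differentiableAt_writtenInExtChartAt {φ : X → Y} {p : X}
    (h : MDifferentiableAt 𝓘(ℂ, ℂ) 𝓘(ℂ, ℂ) φ p) :
    DifferentiableAt ℂ (writtenInExtChartAt 𝓘(ℂ, ℂ) 𝓘(ℂ, ℂ) p φ) (extChartAt 𝓘(ℂ, ℂ) p p) := by
  have h2 := (mdifferentiableAt_iff φ p).1 h
  simpa [ModelWithCorners.Boundaryless.range_eq_univ, differentiableWithinAt_univ] using h2.2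

/-- If `φ` is holomorphic near `p`, its chart expression in the preferred charts at `p` is
differentiable near the base point. [cite: MochizukiAbsTopIII2015, Definition 2.1 (ii) p.51] -/
theorem eventually_differentiableAt_writtenInExtChartAt {φ : X → Y} {p : X} (hφ : ContinuousAt φ p)
    (h : IsHolAt φ p) :
    ∀ᶠ w in 𝓝 (extChartAt 𝓘(ℂ, ℂ) p p),
      DifferentiableAt ℂ (writtenInExtChartAt 𝓘(ℂ, ℂ) 𝓘(ℂ, ℂ) p φ) w := by
  set cX := chartAt ℂ p with hcX
  set cY := chartAt ℂ (φ p) with hcY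
  have hsrc : ∀ᶠ y in 𝓝 p, y ∈ cX.source := cX.open_source.mem_nhds (mem_chart_source ℂ p)
  have htgt : ∀ᶠ y in 𝓝 p, φ y ∈ cY.source :=
    hφ.preimage_mem_nhds (cY.open_source.mem_nhds (mem_chart_source ℂ (φ p)))
  have key : ∀ᶠ y in 𝓝 p, DifferentiableAt ℂ (writtenInExtChartAt 𝓘(ℂ, ℂ) 𝓘(ℂ, ℂ) p φ) (cX y) := by
    filter_upwards [h, hsrc, htgt] with y hy hys hyt
    have h2 := ((mdifferentiableAt_iff_of_mem_source (I := 𝓘(ℂ, ℂ)) (I' := 𝓘(ℂ, ℂ)) hys hyt).1 hy).2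
    simpa [ModelWithCorners.Boundaryless.range_eq_univ, differentiableWithinAt_univ,
      writtenInExtChartAt] using h2
  have hw : extChartAt 𝓘(ℂ, ℂ) p p = cX p := by simp [hcX]
  rw [hw]
  filter_upwards [(cX.eventually_nhds' _ (mem_chart_source ℂ p)).2 key,
    cX.eventually_right_inverse' (mem_chart_source ℂ p)] with w hw' hri
  rwa [hri] at hw'

end Charts

/-! ### Exclusivity of the two types -/

section Types

variable {X Y : Type u} [TopologicalSpace X] [ChartedSpace ℂ X] [IsManifold 𝓘(ℂ, ℂ) ω X]
  [TopologicalSpace Y] [ChartedSpace ℂ Y] [IsManifold 𝓘(ℂ, ℂ) ω Y]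

/-- **Holomorphic and anti-holomorphic points exclude each other** for a homeomorphism of Riemann
surfaces: a map both holomorphic and anti-holomorphic at `p` has zero derivative there in the charts,
but the chart expression of a homeomorphism is injective near the base point, hence has
non-vanishing derivative. [cite: MochizukiAbsTopIII2015, Definition 2.1 (ii) p.51] -/
theorem not_isHolAt_and_isAntiHolAt (φ : X ≃ₜ Y) (p : X) : ¬ (IsHolAt (⇑φ) p ∧ IsAntiHolAt (⇑φ) p) := by
  rintro ⟨hhol, hanti⟩
  set cX := chartAt ℂ p with hcX
  set cY := chartAt ℂ (φ p) with hcY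
  set T := writtenInExtChartAt 𝓘(ℂ, ℂ) 𝓘(ℂ, ℂ) p (⇑φ) with hT
  have hw : extChartAt 𝓘(ℂ, ℂ) p p = cX p := by simp [hcX]
  -- `T` differentiable near `cX p`, `conj ∘ T` differentiable at `cX p`
  have h1 : ∀ᶠ w in 𝓝 (cX p), DifferentiableAt ℂ T w := by
    have := eventually_differentiableAt_writtenInExtChartAt φ.continuous.continuousAt hhol
    rwa [hw] at this
  have h2 : DifferentiableAt ℂ (conj ∘ T) (cX p) := by
    have := (hanti.self_of_nhds).2
    rwa [hw] at this
  -- `T` is injective near `cX p`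
  have hTdef : ∀ w, T w = cY (φ (cX.symm w)) := fun w => by
    simp [hT, writtenInExtChartAt, hcX, hcY]
  set O : Set ℂ := cX.target ∩ cX.symm ⁻¹' (φ ⁻¹' cY.source) with hO
  have hOo : IsOpen O := cX.symm.isOpen_inter_preimage (cY.open_source.preimage φ.continuous)
  have hpO : cX p ∈ O := ⟨mem_chart_target ℂ p, by
    show φ (cX.symm (cX p)) ∈ cY.source
    rw [cX.left_inv (mem_chart_source ℂ p)]; exact mem_chart_source ℂ (φ p)⟩
  have hinj : InjOn T O := by
    intro w hw' w' hw'' hww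
    rw [hTdef, hTdef] at hww
    have h3 : φ (cX.symm w) = φ (cX.symm w') := cY.injOn hw'.2 hw''.2 hww
    have h4 : cX.symm w = cX.symm w' := φ.injective h3
    exact cX.symm.injOn hw'.1 hw''.1 h4
  -- a ball on which `T` is differentiable and injective
  obtain ⟨ε, hε, hball⟩ := Metric.isOpen_iff.1 hOo (cX p) hpO
  obtain ⟨δ, hδ, hballd⟩ := Metric.eventually_nhds_iff_ball.1 h1
  set r := min ε δ with hr
  have hr0 : 0 < r := lt_min hε hδ
  have hdiff : DifferentiableOn ℂ T (ball (cX p) r) := fun w hw' =>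
    (hballd w (ball_subset_ball (min_le_right _ _) hw')).differentiableWithinAt
  have hinj' : InjOn T (ball (cX p) r) := hinj.mono ((ball_subset_ball (min_le_left _ _)).trans hball)
  have hne := Literature.Analysis.Complex.SCV.deriv_ne_zero_of_injOn hdiff isOpen_ball hinj'
    (mem_ball_self hr0)
  exact hne (deriv_eq_zero_of_differentiableAt_conj_comp (hdiff.differentiableAt
    (isOpen_ball.mem_nhds (mem_ball_self hr0))) h2)

omit [IsManifold 𝓘(ℂ, ℂ) ω X] [IsManifold 𝓘(ℂ, ℂ) ω Y] in
/-- The inverse of a homeomorphism that is holomorphic at `p`, and RC-holomorphic at `φ p` in the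
reverse direction, is holomorphic at `φ p` (otherwise `conj` would be `ℂ`-differentiable).
[cite: MochizukiAbsTopIII2015, Definition 2.1 (ii) p.51] -/
theorem isHolAt_symm_of_isHolAt (φ : X ≃ₜ Y) {p : X} (hhol : IsHolAt (⇑φ) p)
    (hrc : IsHolAt (⇑φ.symm) (φ p) ∨ IsAntiHolAt (⇑φ.symm) (φ p)) : IsHolAt (⇑φ.symm) (φ p) := by
  rcases hrc with h | hanti
  · exact h
  exfalso
  set cX := chartAt ℂ p with hcX
  set cY := chartAt ℂ (φ p) with hcY
  set T := writtenInExtChartAt 𝓘(ℂ, ℂ) 𝓘(ℂ, ℂ) p (⇑φ) with hT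
  set T' := writtenInExtChartAt 𝓘(ℂ, ℂ) 𝓘(ℂ, ℂ) (φ p) (⇑φ.symm) with hT'
  have hwX : extChartAt 𝓘(ℂ, ℂ) p p = cX p := by simp [hcX]
  have hwY : extChartAt 𝓘(ℂ, ℂ) (φ p) (φ p) = cY (φ p) := by simp [hcY]
  have hTdef : ∀ w, T w = cY (φ (cX.symm w)) := fun w => by
    simp [hT, writtenInExtChartAt, hcX, hcY]
  have hT'def : ∀ v, T' v = cX (φ.symm (cY.symm v)) := fun v => by
    simp [hT', writtenInExtChartAt, hcX, hcY, Homeomorph.symm_apply_apply]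
  -- `T` differentiable at `cX p`, `conj ∘ T'` differentiable at `cY (φ p) = T (cX p)`
  have h1 : DifferentiableAt ℂ T (cX p) := by
    have := differentiableAt_writtenInExtChartAt (hhol.self_of_nhds); rwa [hwX] at this
  have h2 : DifferentiableAt ℂ (conj ∘ T') (T (cX p)) := by
    have := (hanti.self_of_nhds).2
    rw [hwY] at this
    rwa [hTdef, cX.left_inv (mem_chart_source ℂ p)]
  have h3 : DifferentiableAt ℂ ((conj ∘ T') ∘ T) (cX p) := h2.comp _ h1
  -- `(conj ∘ T') ∘ T = conj` near `cX p`
  have hnear : ∀ᶠ w in 𝓝 (cX p), ((conj ∘ T') ∘ T) w = conj w := by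
    have hsrc : ∀ᶠ y in 𝓝 p, φ y ∈ cY.source :=
      φ.continuous.continuousAt.preimage_mem_nhds (cY.open_source.mem_nhds (mem_chart_source ℂ _))
    have key : ∀ᶠ y in 𝓝 p, ((conj ∘ T') ∘ T) (cX y) = conj (cX y) := by
      filter_upwards [hsrc, cX.open_source.mem_nhds (mem_chart_source ℂ p)] with y hy hys
      simp only [comp_apply, hTdef, hT'def, cX.left_inv hys, cY.left_inv hy, Homeomorph.symm_apply_apply]
    filter_upwards [(cX.eventually_nhds' _ (mem_chart_source ℂ p)).2 key,
      cX.eventually_right_inverse' (mem_chart_source ℂ p)] with w hw' hri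
    rwa [hri] at hw'
  -- `conj` would be `ℂ`-differentiable at `cX p`: contradiction with Cauchy–Riemann
  -- (the same one-variable fact is `…Balaban1983to89.T4ActivityRecursionWitness.not_differentiableAt_conj`
  -- in the tree; re-derived inline to keep the import graph topical)
  have hconj : DifferentiableAt ℂ (fun z : ℂ => conj z) (cX p) :=
    (Filter.EventuallyEq.differentiableAt_iff hnear).1 h3
  have hc : (fun z : ℂ => conj z) = ⇑Complex.conjCLE := funext fun z => (Complex.conjCLE_apply z).symm
  have cr := (differentiableAt_complex_iff_differentiableAt_real.1 hconj).2
  rw [hc, Complex.conjCLE.fderiv] at cr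
  simp only [ContinuousLinearEquiv.coe_coe, Complex.conjCLE_apply, Complex.conj_I, map_one,
    smul_eq_mul, mul_one] at cr
  have := congrArg Complex.im cr
  norm_num at this

/-- The inverse of a homeomorphism that is anti-holomorphic at `p` (and RC-holomorphic in both
directions) is anti-holomorphic at `φ p`. [cite: MochizukiAbsTopIII2015, Definition 2.1 (ii) p.51] -/
theorem isAntiHolAt_symm_of_isAntiHolAt (φ : X ≃ₜ Y) {p : X} (hanti : IsAntiHolAt (⇑φ) p)
    (hrcY : IsHolAt (⇑φ.symm) (φ p) ∨ IsAntiHolAt (⇑φ.symm) (φ p))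
    (hrcX : IsHolAt (⇑φ.symm.symm) (φ.symm (φ p)) ∨ IsAntiHolAt (⇑φ.symm.symm) (φ.symm (φ p))) :
    IsAntiHolAt (⇑φ.symm) (φ p) := by
  rcases hrcY with hhol | h
  · exfalso
    have h' := isHolAt_symm_of_isHolAt φ.symm hhol hrcX
    rw [Homeomorph.symm_symm, φ.symm_apply_apply] at h'
    exact not_isHolAt_and_isAntiHolAt φ p ⟨h', hanti⟩
  · exact h

omit [IsManifold 𝓘(ℂ, ℂ) ω X] [IsManifold 𝓘(ℂ, ℂ) ω Y] in
/-- The sets of holomorphic, resp. anti-holomorphic, points are open.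
[cite: MochizukiAbsTopIII2015, Definition 2.1 (ii) p.51] -/
theorem isOpen_setOf_isHolAt (φ : X → Y) : IsOpen {p | IsHolAt φ p} :=
  isOpen_setOf_eventually_nhds

omit [IsManifold 𝓘(ℂ, ℂ) ω X] [IsManifold 𝓘(ℂ, ℂ) ω Y] in
/-- The set of anti-holomorphic points is open. [cite: MochizukiAbsTopIII2015, Definition 2.1 (ii) p.51] -/
theorem isOpen_setOf_isAntiHolAt (φ : X → Y) : IsOpen {p | IsAntiHolAt φ p} :=
  isOpen_setOf_eventually_nhds

/-- **On a preconnected set the type is constant**: an RC-holomorphic homeomorphism is either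
holomorphic at every point of a preconnected `W` or anti-holomorphic at every point of `W`.
[cite: MochizukiAbsTopIII2015, Corollary 2.3 (i) p.53] -/
theorem forall_isHolAt_or_forall_isAntiHolAt (φ : X ≃ₜ Y) (hrc : IsRCHolomorphic (⇑φ)) {W : Set X}
    (hW : IsPreconnected W) :
    (∀ p ∈ W, IsHolAt (⇑φ) p) ∨ ∀ p ∈ W, IsAntiHolAt (⇑φ) p := by
  have hsub : W ⊆ {p | IsHolAt (⇑φ) p} ∪ {p | IsAntiHolAt (⇑φ) p} := fun p _ => hrc p
  have hdisj : Disjoint {p | IsHolAt (⇑φ) p} {p | IsAntiHolAt (⇑φ) p} :=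
    Set.disjoint_left.2 fun p h1 h2 => not_isHolAt_and_isAntiHolAt φ p ⟨h1, h2⟩
  rcases hW.subset_or_subset (isOpen_setOf_isHolAt _) (isOpen_setOf_isAntiHolAt _) hdisj hsub with h | h
  · exact Or.inl fun p hp => h hp
  · exact Or.inr fun p hp => h hp

end Types

end Literature.AnabelianGeometry.AbsoluteAnabelian
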